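import Summits.QuantumAdvantage.QuantumAdvantage.Theses.CharDial
import Summits.QuantumAdvantage.QuantumAdvantage.Theorems.CharDialSegmentMovesL
import Summits.QuantumAdvantage.QuantumAdvantage.Theorems.CharDialRankRate
import HarnessLib

/-!
# CharDial / JLinPeel — THE DIAL TOWER of the crux `WalkHardFJLinOdd`, part A: the variation dial and the first two decided dials, BY NAME
(route `CharDial`, item 32604; lens-6 nodes g17–g18; land-port of the annex's Theses-level piece spine onto the tree twins, NODE-g18.md §11.3)

This module imports the ROUTE file `Theses.CharDial` only to state the crux `WalkHardFJLinOdd` BY NAME in the junction theorems (precedent: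
`Theorems.LengthDialG`); everything else is stated over `JLinPeel.JLinData`, `SegMove.lowPositions` and `ringWinU`.

* `JLinHyp p n y` — the hypothesis of the crux on a strategy (every cut a `log₂ n`-junta ⊕ one linear form mod `p`); `exists_jlinData_of_hyp`.
* `LowVar B n y := n ≤ 2·#SegMove.lowPositions n y (B n)` — the VARIATION DIAL (at least half the positions carry swap-influence mass `≤ B n·2ⁿ`),
  default schedule `dialB n = 4(log₂ n + 1)`; pieces `LowSide B` / `HighSide B`; ★ junction 1 `walkHardFJLinOdd_iff_dial (B) : T ↔ LowSide B ∧ HighSide B`.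
* `SpanHyp D` (RANK dial: the presented forms of the non-constant-table cuts lie in the span of `cubeRate n` vectors) and `SparseHyp D` (SPARSE-free-set
  dial) — both DECIDED for `log₂ n`-juntas: `spanDial_hard` (= `JLinPeel.cubeRank_hard`, primes `p ≥ 5`) and `sparseDial_hard` (= `SegMove.sparse_hard`);
  `ResidualSide`; ★ junction 2 `walkHardFJLinOdd_iff_residual : T ↔ ResidualSide`.
* `ResidualHighSide B`; ★ `highSide_iff_residualHigh`, ★ `walkHardFJLinOdd_iff_low_and_residualHigh (B) : T ↔ LowSide B ∧ ResidualHighSide B`,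
  `walkHardFJLinOdd_iff_sharpened` (at `dialB`).

Every `iff` records that the pieces are jointly EQUIVALENT to the crux (neither side is claimed easier).  Parts B–D peel the block, null and mask dials
and certify that the final residual class is inhabited.  0 sorry.
-/

set_option autoImplicit false

namespace Summit.QuantumAdvantage.AdviceFreeQNC0.JLinPeel.Tower

open Finset

variable {n : ℕ}

section Dial

/-- the hypothesis of `CharDial.WalkHardFJLinOdd`, verbatim: every cut is a `log₂ n`-junta ⊕ ONE `𝔽_p`-linear form. -/
def JLinHyp (p n : ℕ) (y : Fin (n + 1) → (Fin n → Bool) → Bool) : Prop :=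
  ∀ g, ∃ J : Finset (Fin n), J.card ≤ Nat.log 2 n ∧ ∃ a : Fin n → ZMod p,
    ∃ h : (Fin n → Bool) → ZMod p → Bool, (∀ u v : Fin n → Bool, (∀ i ∈ J, u i = v i) → ∀ s, h u s = h v s) ∧
      ∀ u, y g u = h u (∑ i, if u i then a i else 0)

/-- the dial predicate: at least half of the positions have low variation at threshold `B n` (swap-influence mass, tree `SegMove.lowPositions`). -/
def LowVar (B : ℕ → ℕ) (n : ℕ) (y : Fin (n + 1) → (Fin n → Bool) → Bool) : Prop :=
  n ≤ 2 * (SegMove.lowPositions n y (B n)).card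

/-- the node's default threshold schedule: four juntas' worth, `B n = 4·(log₂ n + 1)`. -/
def dialB (n : ℕ) : ℕ := 4 * (Nat.log 2 n + 1)

/-- **piece LOW (bounded variation).** `WalkHardFJLinOdd` restricted to strategies on the LOW side of the dial. -/
def LowSide (B : ℕ → ℕ) : Prop :=
  ∀ (p : ℕ) [Fact p.Prime], 5 ≤ p → ∃ θ : ℝ, θ < 1 ∧ ∃ n₀ : ℕ, ∀ n ≥ n₀, ∀ c : ℕ,
    ∀ y : Fin (n + 1) → (Fin n → Bool) → Bool, JLinHyp p n y → LowVar B n y →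
      ((Finset.univ.filter fun u : Fin n → Bool => ringWinU c y u = true).card : ℝ) ≤ θ * (2 : ℝ) ^ n

/-- **piece HIGH (large variation).** `WalkHardFJLinOdd` restricted to strategies on the HIGH side of the dial. -/
def HighSide (B : ℕ → ℕ) : Prop :=
  ∀ (p : ℕ) [Fact p.Prime], 5 ≤ p → ∃ θ : ℝ, θ < 1 ∧ ∃ n₀ : ℕ, ∀ n ≥ n₀, ∀ c : ℕ,
    ∀ y : Fin (n + 1) → (Fin n → Bool) → Bool, JLinHyp p n y → ¬ LowVar B n y →
      ((Finset.univ.filter fun u : Fin n → Bool => ringWinU c y u = true).card : ℝ) ≤ θ * (2 : ℝ) ^ n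

/-- **JUNCTION (proved, by name).** for every threshold schedule `B`, the CharDial crux `WalkHardFJLinOdd` is EQUIVALENT to the
conjunction of its two dial pieces. -/
theorem walkHardFJLinOdd_iff_dial (B : ℕ → ℕ) :
    Summit.QuantumAdvantage.QuantumAdvantage.Theses.CharDial.WalkHardFJLinOdd ↔ LowSide B ∧ HighSide B := by
  constructor
  · intro hT
    refine ⟨fun p _ hp => ?_, fun p _ hp => ?_⟩
    · obtain ⟨θ, hθ, n₀, hn₀⟩ := hT p hp
      exact ⟨θ, hθ, n₀, fun n hn c y hy _ => hn₀ n hn c y hy⟩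
    · obtain ⟨θ, hθ, n₀, hn₀⟩ := hT p hp
      exact ⟨θ, hθ, n₀, fun n hn c y hy _ => hn₀ n hn c y hy⟩
  · rintro ⟨hL, hH⟩ p _ hp
    obtain ⟨θ₁, hθ₁, n₁, h₁⟩ := hL p hp
    obtain ⟨θ₂, hθ₂, n₂, h₂⟩ := hH p hp
    refine ⟨max θ₁ θ₂, max_lt hθ₁ hθ₂, max n₁ n₂, fun n hn c y hy => ?_⟩
    have hpow : (0 : ℝ) ≤ (2 : ℝ) ^ n := by positivity
    by_cases hv : LowVar B n y
    · calc ((Finset.univ.filter fun u : Fin n → Bool => ringWinU c y u = true).card : ℝ)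
          ≤ θ₁ * (2 : ℝ) ^ n := h₁ n (le_trans (le_max_left _ _) hn) c y hy hv
        _ ≤ max θ₁ θ₂ * (2 : ℝ) ^ n := mul_le_mul_of_nonneg_right (le_max_left _ _) hpow
    · calc ((Finset.univ.filter fun u : Fin n → Bool => ringWinU c y u = true).card : ℝ)
          ≤ θ₂ * (2 : ℝ) ^ n := h₂ n (le_trans (le_max_right _ _) hn) c y hy hv
        _ ≤ max θ₁ θ₂ * (2 : ℝ) ^ n := mul_le_mul_of_nonneg_right (le_max_right _ _) hpow

/-- the two one-way junctions, for the critic's probes. -/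
theorem walkHardFJLinOdd_of_dial (B : ℕ → ℕ) (hL : LowSide B) (hH : HighSide B) :
    Summit.QuantumAdvantage.QuantumAdvantage.Theses.CharDial.WalkHardFJLinOdd :=
  (walkHardFJLinOdd_iff_dial B).mpr ⟨hL, hH⟩

/-- T implies the LOW piece (projection). -/
theorem lowSide_of_walkHardFJLinOdd (B : ℕ → ℕ)
    (h : Summit.QuantumAdvantage.QuantumAdvantage.Theses.CharDial.WalkHardFJLinOdd) : LowSide B :=
  ((walkHardFJLinOdd_iff_dial B).mp h).1

/-- T implies the HIGH piece (projection). -/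
theorem highSide_of_walkHardFJLinOdd (B : ℕ → ℕ)
    (h : Summit.QuantumAdvantage.QuantumAdvantage.Theses.CharDial.WalkHardFJLinOdd) : HighSide B :=
  ((walkHardFJLinOdd_iff_dial B).mp h).2

end Dial

section Residual

variable {p : ℕ}

/-- the RANK DIAL hypothesis on a presentation: the forms of the non-constant cuts lie in a span of dimension `cubeRate n`. -/
def SpanHyp (D : JLinPeel.JLinData p n) : Prop :=
  ∃ A : Fin (JLinPeel.cubeRate n) → Fin n → ZMod p,
    ∀ g, ¬ (∀ (u : Fin n → Bool) (s s' : ZMod p), D.h g u s = D.h g u s') →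
      ∃ l : Fin (JLinPeel.cubeRate n) → ZMod p, D.a g = fun i => ∑ j, l j * A j i

/-- the SPARSE-FREE-SET DIAL hypothesis on a presentation: some set `S` of `≥ log₂ n` coordinates meets every cut's junta ∪ form-support in
`≤ √#S` points (only the part of the junta INSIDE `S` is charged — the rest is fixed on the subcubes; sharpened after critic row 67v38). -/
def SparseHyp (D : JLinPeel.JLinData p n) : Prop :=
  ∃ S : Finset (Fin n), Nat.log 2 n ≤ S.card ∧
    ∀ g, (S.filter fun i => i ∈ D.J g ∨ D.a g i ≠ 0).card ≤ Nat.sqrt S.card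

/-- **the RESIDUAL of T**: `WalkHardFJLinOdd` restricted to strategies all of whose `log₂ n`-junta ⊕ form presentations escape BOTH dials. -/
def ResidualSide : Prop :=
  ∀ (p : ℕ) [Fact p.Prime], 5 ≤ p → ∃ θ : ℝ, θ < 1 ∧ ∃ n₀ : ℕ, ∀ n ≥ n₀, ∀ c : ℕ,
    ∀ y : Fin (n + 1) → (Fin n → Bool) → Bool, JLinHyp p n y →
      (∀ D : JLinPeel.JLinData p n, D.strat = y → (∀ g, (D.J g).card ≤ Nat.log 2 n) → ¬ SpanHyp D ∧ ¬ SparseHyp D) →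
        ((Finset.univ.filter fun u : Fin n → Bool => ringWinU c y u = true).card : ℝ) ≤ θ * (2 : ℝ) ^ n

/-- the verbatim hypothesis of T yields a presentation. -/
theorem exists_jlinData_of_hyp {y : Fin (n + 1) → (Fin n → Bool) → Bool} (hy : JLinHyp p n y) :
    ∃ D : JLinPeel.JLinData p n, D.strat = y ∧ ∀ g, (D.J g).card ≤ Nat.log 2 n := by
  choose J hJ a h hh hyg using hy
  refine ⟨⟨J, a, h, fun g u v huv s => hh g u v huv s⟩, ?_, hJ⟩
  funext g u
  exact (hyg g u).symm

/-- **the rank dial is decided** (`JLinPeel.cubeRank_hard`, by name). -/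
theorem spanDial_hard (p : ℕ) [Fact p.Prime] (hp5 : 5 ≤ p) :
    ∃ θ : ℝ, θ < 1 ∧ ∃ n₀ : ℕ, ∀ n ≥ n₀, ∀ (c : ℕ) (D : JLinPeel.JLinData p n),
      (∀ g, (D.J g).card ≤ Nat.log 2 n) → SpanHyp D →
        ((univ.filter fun u : Fin n → Bool => ringWinU c D.strat u = true).card : ℝ) ≤ θ * (2 : ℝ) ^ n := by
  obtain ⟨θ, hθ, n₀, hn₀⟩ := JLinPeel.cubeRank_hard p hp5
  exact ⟨θ, hθ, n₀, fun n hn c D hJ hS => hn₀ n hn c D hJ hS⟩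

/-- ★ **the sparse-free-set dial is decided**: one common set of `≥ log₂ n` coordinates read sparsely (`≤ √#S` of them, junta bits inside `S`
included) by every cut forces `≤ θ·2ⁿ` wins — the subcube tube-rank engine + double counting (no junta-size and no rank hypothesis needed; any `p`). -/
theorem sparseDial_hard (p : ℕ) :
    ∃ θ : ℝ, θ < 1 ∧ ∃ n₀ : ℕ, ∀ n ≥ n₀, ∀ (c : ℕ) (D : JLinPeel.JLinData p n), SparseHyp D →
      ((univ.filter fun u : Fin n → Bool => ringWinU c D.strat u = true).card : ℝ) ≤ θ * (2 : ℝ) ^ n := by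
  obtain ⟨θ, hθ, n₀, h⟩ := SegMove.sparse_hard p
  exact ⟨θ, hθ, n₀, fun n hn c D hS => h n hn c D hS⟩

/-- ★ **JUNCTION (proved, by name): T ⟺ its RESIDUAL.**  `WalkHardFJLinOdd` is EQUIVALENT to its restriction to strategies all of whose
`log₂ n`-junta ⊕ form presentations escape both the rank dial and the sparse-free-set dial (the two decided regions peeled off). -/
theorem walkHardFJLinOdd_iff_residual :
    Summit.QuantumAdvantage.QuantumAdvantage.Theses.CharDial.WalkHardFJLinOdd ↔ ResidualSide := by
  constructor
  · intro hT p _ hp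
    obtain ⟨θ, hθ, n₀, hn₀⟩ := hT p hp
    exact ⟨θ, hθ, n₀, fun n hn c y hy _ => hn₀ n hn c y hy⟩
  · intro hR p _ hp
    obtain ⟨θ₁, hθ₁, n₁, h₁⟩ := spanDial_hard p hp
    obtain ⟨θ₂, hθ₂, n₂, h₂⟩ := sparseDial_hard p
    obtain ⟨θ₃, hθ₃, n₃, h₃⟩ := hR p hp
    refine ⟨max (max θ₁ θ₂) θ₃, max_lt (max_lt hθ₁ hθ₂) hθ₃, max (max n₁ n₂) n₃, fun n hn c y hy => ?_⟩
    have hpow : (0 : ℝ) ≤ (2 : ℝ) ^ n := by positivity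
    have hn1 : n₁ ≤ n := le_trans (le_trans (le_max_left _ _) (le_max_left _ _)) hn
    have hn2 : n₂ ≤ n := le_trans (le_trans (le_max_right _ _) (le_max_left _ _)) hn
    have hn3 : n₃ ≤ n := le_trans (le_max_right _ _) hn
    by_cases hdial : ∃ D : JLinPeel.JLinData p n, D.strat = y ∧ (∀ g, (D.J g).card ≤ Nat.log 2 n) ∧ (SpanHyp D ∨ SparseHyp D)
    · obtain ⟨D, hDy, hJ, hS | hS⟩ := hdial
      · rw [← hDy]
        exact le_trans (h₁ n hn1 c D hJ hS)
          (mul_le_mul_of_nonneg_right (le_trans (le_max_left _ _) (le_max_left _ _)) hpow)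
      · rw [← hDy]
        exact le_trans (h₂ n hn2 c D hS)
          (mul_le_mul_of_nonneg_right (le_trans (le_max_right _ _) (le_max_left _ _)) hpow)
    · have hesc : ∀ D : JLinPeel.JLinData p n, D.strat = y → (∀ g, (D.J g).card ≤ Nat.log 2 n) →
          ¬ SpanHyp D ∧ ¬ SparseHyp D := fun D hDy hJ =>
        ⟨fun hS => hdial ⟨D, hDy, hJ, Or.inl hS⟩, fun hS => hdial ⟨D, hDy, hJ, Or.inr hS⟩⟩
      exact le_trans (h₃ n hn3 c y hy hesc) (mul_le_mul_of_nonneg_right (le_max_right _ _) hpow)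

/-- T implies its residual (projection; the content of the junction is the converse). -/
theorem residualSide_of_walkHardFJLinOdd
    (hT : Summit.QuantumAdvantage.QuantumAdvantage.Theses.CharDial.WalkHardFJLinOdd) : ResidualSide :=
  walkHardFJLinOdd_iff_residual.mp hT

end Residual

section ResidualHigh

variable {p : ℕ}

/-- **piece RESIDUAL-HIGH.** `WalkHardFJLinOdd` restricted to HIGH-variation strategies all of whose `log₂ n`-junta ⊕ form presentations escape
both decided dials. -/
def ResidualHighSide (B : ℕ → ℕ) : Prop :=
  ∀ (p : ℕ) [Fact p.Prime], 5 ≤ p → ∃ θ : ℝ, θ < 1 ∧ ∃ n₀ : ℕ, ∀ n ≥ n₀, ∀ c : ℕ,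
    ∀ y : Fin (n + 1) → (Fin n → Bool) → Bool, JLinHyp p n y → ¬ LowVar B n y →
      (∀ D : JLinPeel.JLinData p n, D.strat = y → (∀ g, (D.J g).card ≤ Nat.log 2 n) → ¬ SpanHyp D ∧ ¬ SparseHyp D) →
        ((Finset.univ.filter fun u : Fin n → Bool => ringWinU c y u = true).card : ℝ) ≤ θ * (2 : ℝ) ^ n

/-- HIGH implies its residual part (projection). -/
theorem residualHighSide_of_highSide (B : ℕ → ℕ) (h : HighSide B) : ResidualHighSide B := by
  intro p _ hp
  obtain ⟨θ, hθ, n₀, hn₀⟩ := h p hp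
  exact ⟨θ, hθ, n₀, fun n hn c y hy hv _ => hn₀ n hn c y hy hv⟩

/-- the residual implies the residual-high part (projection). -/
theorem residualHighSide_of_residualSide (B : ℕ → ℕ) (h : ResidualSide) : ResidualHighSide B := by
  intro p _ hp
  obtain ⟨θ, hθ, n₀, hn₀⟩ := h p hp
  exact ⟨θ, hθ, n₀, fun n hn c y hy _ hesc => hn₀ n hn c y hy hesc⟩

/-- ★ **HIGH ⟺ RESIDUAL-HIGH** (every schedule): the two decided dials are absorbed — the HIGH piece of §37e IS its residual part. -/
theorem highSide_iff_residualHigh (B : ℕ → ℕ) : HighSide B ↔ ResidualHighSide B := by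
  refine ⟨residualHighSide_of_highSide B, fun hRH p _ hp => ?_⟩
  obtain ⟨θ₂, hθ₂, n₂, h₂⟩ := spanDial_hard p hp
  obtain ⟨θ₃, hθ₃, n₃, h₃⟩ := sparseDial_hard p
  obtain ⟨θ₄, hθ₄, n₄, h₄⟩ := hRH p hp
  refine ⟨max θ₂ (max θ₃ θ₄), max_lt hθ₂ (max_lt hθ₃ hθ₄), max n₂ (max n₃ n₄), fun n hn c y hy hv => ?_⟩
  have hpow : (0 : ℝ) ≤ (2 : ℝ) ^ n := by positivity
  have hn2 : n₂ ≤ n := le_trans (le_max_left _ _) hn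
  have hn3 : n₃ ≤ n := le_trans (le_trans (le_max_left _ _) (le_max_right _ _)) hn
  have hn4 : n₄ ≤ n := le_trans (le_trans (le_max_right _ _) (le_max_right _ _)) hn
  by_cases hdial : ∃ D : JLinPeel.JLinData p n, D.strat = y ∧ (∀ g, (D.J g).card ≤ Nat.log 2 n) ∧ (SpanHyp D ∨ SparseHyp D)
  · obtain ⟨D, hDy, hJ, hS | hS⟩ := hdial
    · rw [← hDy]
      exact le_trans (h₂ n hn2 c D hJ hS) (mul_le_mul_of_nonneg_right (le_max_left _ _) hpow)
    · rw [← hDy]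
      exact le_trans (h₃ n hn3 c D hS)
        (mul_le_mul_of_nonneg_right (le_trans (le_max_left _ _) (le_max_right _ _)) hpow)
  · have hesc : ∀ D : JLinPeel.JLinData p n, D.strat = y → (∀ g, (D.J g).card ≤ Nat.log 2 n) →
        ¬ SpanHyp D ∧ ¬ SparseHyp D := fun D hDy hJ =>
      ⟨fun hS => hdial ⟨D, hDy, hJ, Or.inl hS⟩, fun hS => hdial ⟨D, hDy, hJ, Or.inr hS⟩⟩
    exact le_trans (h₄ n hn4 c y hy hv hesc)
      (mul_le_mul_of_nonneg_right (le_trans (le_max_right _ _) (le_max_right _ _)) hpow)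

/-- ★ **JUNCTION 3 (proved, by name): the sharpened split.**  For every threshold schedule `B`, the CharDial crux `WalkHardFJLinOdd` is
EQUIVALENT to LOW ∧ RESIDUAL-HIGH. -/
theorem walkHardFJLinOdd_iff_low_and_residualHigh (B : ℕ → ℕ) :
    Summit.QuantumAdvantage.QuantumAdvantage.Theses.CharDial.WalkHardFJLinOdd ↔ LowSide B ∧ ResidualHighSide B := by
  constructor
  · intro hT
    have h1 := (walkHardFJLinOdd_iff_dial B).mp hT
    exact ⟨h1.1, residualHighSide_of_highSide B h1.2⟩
  · rintro ⟨hL, hRH⟩ p _ hp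
    obtain ⟨θ₁, hθ₁, n₁, h₁⟩ := hL p hp
    obtain ⟨θ₂, hθ₂, n₂, h₂⟩ := spanDial_hard p hp
    obtain ⟨θ₃, hθ₃, n₃, h₃⟩ := sparseDial_hard p
    obtain ⟨θ₄, hθ₄, n₄, h₄⟩ := hRH p hp
    refine ⟨max (max θ₁ θ₂) (max θ₃ θ₄), max_lt (max_lt hθ₁ hθ₂) (max_lt hθ₃ hθ₄),
      max (max n₁ n₂) (max n₃ n₄), fun n hn c y hy => ?_⟩
    have hpow : (0 : ℝ) ≤ (2 : ℝ) ^ n := by positivity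
    have hn1 : n₁ ≤ n := le_trans (le_trans (le_max_left _ _) (le_max_left _ _)) hn
    have hn2 : n₂ ≤ n := le_trans (le_trans (le_max_right _ _) (le_max_left _ _)) hn
    have hn3 : n₃ ≤ n := le_trans (le_trans (le_max_left _ _) (le_max_right _ _)) hn
    have hn4 : n₄ ≤ n := le_trans (le_trans (le_max_right _ _) (le_max_right _ _)) hn
    have hθ1 : θ₁ ≤ max (max θ₁ θ₂) (max θ₃ θ₄) := le_trans (le_max_left _ _) (le_max_left _ _)
    have hθ2 : θ₂ ≤ max (max θ₁ θ₂) (max θ₃ θ₄) := le_trans (le_max_right _ _) (le_max_left _ _)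
    have hθ3 : θ₃ ≤ max (max θ₁ θ₂) (max θ₃ θ₄) := le_trans (le_max_left _ _) (le_max_right _ _)
    have hθ4 : θ₄ ≤ max (max θ₁ θ₂) (max θ₃ θ₄) := le_trans (le_max_right _ _) (le_max_right _ _)
    by_cases hv : LowVar B n y
    · exact le_trans (h₁ n hn1 c y hy hv) (mul_le_mul_of_nonneg_right hθ1 hpow)
    · by_cases hdial : ∃ D : JLinPeel.JLinData p n, D.strat = y ∧ (∀ g, (D.J g).card ≤ Nat.log 2 n) ∧ (SpanHyp D ∨ SparseHyp D)
      · obtain ⟨D, hDy, hJ, hS | hS⟩ := hdial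
        · rw [← hDy]
          exact le_trans (h₂ n hn2 c D hJ hS) (mul_le_mul_of_nonneg_right hθ2 hpow)
        · rw [← hDy]
          exact le_trans (h₃ n hn3 c D hS) (mul_le_mul_of_nonneg_right hθ3 hpow)
      · have hesc : ∀ D : JLinPeel.JLinData p n, D.strat = y → (∀ g, (D.J g).card ≤ Nat.log 2 n) →
            ¬ SpanHyp D ∧ ¬ SparseHyp D := fun D hDy hJ =>
          ⟨fun hS => hdial ⟨D, hDy, hJ, Or.inl hS⟩, fun hS => hdial ⟨D, hDy, hJ, Or.inr hS⟩⟩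
        exact le_trans (h₄ n hn4 c y hy hv hesc) (mul_le_mul_of_nonneg_right hθ4 hpow)

/-- the three typed pieces of this node, by name: T ⟺ LOW(dialB) ∧ RESIDUAL-HIGH(dialB). -/
theorem walkHardFJLinOdd_iff_sharpened :
    Summit.QuantumAdvantage.QuantumAdvantage.Theses.CharDial.WalkHardFJLinOdd ↔ LowSide dialB ∧ ResidualHighSide dialB :=
  walkHardFJLinOdd_iff_low_and_residualHigh dialB

end ResidualHigh

end Summit.QuantumAdvantage.AdviceFreeQNC0.JLinPeel.Tower
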